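import Summits.Parity.BatemanHorn.Theorems.SoloInformedTwinPrimeTiers
import Literature.NumberTheory.Sieve.HardyLittlewoodTwinSieveLevel

/-!
# SoloInformedTwinPrimeParityFloor — the parity floor of upper-bound sieves, read on the located divisor sum

Solo unit `solo-Parity-informed` (ideation tier, informed mode), session 26; `PLAN.md` §34, CLAIMS C103.

Fix `0 < ε < 1` and put `T(x) := ∑_{n ≤ x} ∑_{e ∣ n(n+2), e > x^{1-ε}} μ(e) log² e`, `C₂` the twin prime constant.
`SoloInformedTwinPrimeTiers` proved (Tier 0) `-(4C₂ + δ)·x ≤ T(x) ≤ (12C₂ + δ)·x` eventually, the ceiling being the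
PROVED sieve constant `4` (Bombieri–Davenport: the linear sieve at the Bombieri–Vinogradov level), and in general that a
sieve constant `C` (`TwinSieveUpperBound C`: `π₂(x) ≤ (C + o(1))·2C₂ x/log² x`) transfers to `T(x) ≤ (4(C-1)C₂ + δ)·x`.
This file feeds that transfer with a LEVEL OF DISTRIBUTION of the primes, through the tree's
`TwinSieveLevel.twinSieveUpperBound_of_level` (level `x^ϑ` ⟹ constant `2/ϑ`, Lichtman 2025 §1.1; proved in the tree
from Iwaniec's linear sieve):

* `eventually_twinTail_le_of_level` — `PrimesHaveLevel ϑ` (`0 < ϑ`) gives `T(x) ≤ (4(2/ϑ - 1)C₂ + δ)·x` eventually;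
  `eventually_twinTail_le_of_level_lt` — the same from `∀ ϑ < ϑ₀, PrimesHaveLevel ϑ` with `2/ϑ₀`
  (`ϑ₀ = 1/2`, Bombieri–Vinogradov, a theorem: the ceiling `12C₂` of `eventually_twinTail_le_mul` again, as an `example`);
* `eventually_twinTail_le_of_EH`, `eventually_abs_twinTail_le_of_EH` — under the Elliott–Halberstam conjecture
  (`Literature.NumberTheory.Sieve.LevelOfDistribution.ElliottHalberstam`, OPEN, a hypothesis) the ceiling drops to the
  mirror image of the trivial floor: `|T(x)| ≤ (4C₂ + δ)·x` eventually, for every `δ > 0`.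

So, on this one real sequence: theorems confine `T(x)/x` to `[-4C₂, 12C₂]` (`+o(1)`); a level `ϑ` of the primes
confines it to `[-4C₂, (8/ϑ - 4)C₂]`; the Elliott–Halberstam level `ϑ = 1` to the SYMMETRIC interval `[-4C₂, 4C₂]`
— the parity constant `2` of upper-bound sieves, now a kernel statement about the sign of `μ` on the divisors
`e > x^{1-ε}` of `n(n+2)`.  The left end is `θ ≥ 0`; any improvement of it by a constant along a sequence is the twin
prime conjecture (`twinPrimeConjecture_of_frequently_twinTail_ge`); `T(x)/x → 0` is Hardy–Littlewood
(`twinPrime_isEquivalent_iff_tail_isLittleO`).  Nothing here makes any tier easier; EH is not known to move the left end.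
-/

namespace Summit.Parity.BatemanHorn.Theorems

open Finset Filter ArithmeticFunction
open scoped ArithmeticFunction.Moebius
open Literature.NumberTheory.Sieve (twinPrimeConst TwinSieveUpperBound PrimesHaveLevel
  BombieriVinogradovStatement_holds ElliottHalberstamConjecture)
open Literature.NumberTheory.Sieve.TwinSieveLevel (twinSieveUpperBound_of_level twinSieveUpperBound_of_level_lt
  twinSieveUpperBound_two_of_EH twinSieveUpperBound_two_of_elliottHalberstamConjecture)

/-! ### A level of distribution `ϑ` on the located sum: ceiling `(8/ϑ - 4)C₂` -/

/-- **Level `ϑ` of the primes ⟹ `T(x) ≤ (4(2/ϑ - 1)C₂ + δ)·x` eventually** (`δ > 0`): the sieve constant `2/ϑ`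
(`TwinSieveLevel.twinSieveUpperBound_of_level`) through `eventually_twinTail_le_of_twinSieveUpperBound`.
`PrimesHaveLevel ϑ` is a theorem of the tree for `ϑ ≤ 1/2` and an open conjecture beyond. -/
theorem eventually_twinTail_le_of_level {θ : ℝ} (hθ : 0 < θ) (hL : PrimesHaveLevel θ)
    {ε : ℝ} (hε : 0 < ε) (hε1 : ε < 1) {δ : ℝ} (hδ : 0 < δ) :
    ∀ᶠ x : ℕ in atTop,
      ∑ n ∈ Icc 1 x, ∑ e ∈ (n * (n + 2)).divisors with ⌊(x : ℝ) ^ (1 - ε)⌋₊ < e,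
          (μ e : ℝ) * Real.log e ^ 2 ≤ (4 * (2 / θ - 1) * twinPrimeConst + δ) * (x : ℝ) :=
  eventually_twinTail_le_of_twinSieveUpperBound (by positivity) (twinSieveUpperBound_of_level hL hθ) hε hε1 hδ

/-- The same from the shape "level `x^ϑ` for every `ϑ < ϑ₀`" (Bombieri–Vinogradov: `ϑ₀ = 1/2`;
Elliott–Halberstam: `ϑ₀ = 1`): `T(x) ≤ (4(2/ϑ₀ - 1)C₂ + δ)·x` eventually. -/
theorem eventually_twinTail_le_of_level_lt {θ₀ : ℝ} (hθ₀ : 0 < θ₀)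
    (h : ∀ θ : ℝ, θ < θ₀ → PrimesHaveLevel θ)
    {ε : ℝ} (hε : 0 < ε) (hε1 : ε < 1) {δ : ℝ} (hδ : 0 < δ) :
    ∀ᶠ x : ℕ in atTop,
      ∑ n ∈ Icc 1 x, ∑ e ∈ (n * (n + 2)).divisors with ⌊(x : ℝ) ^ (1 - ε)⌋₊ < e,
          (μ e : ℝ) * Real.log e ^ 2 ≤ (4 * (2 / θ₀ - 1) * twinPrimeConst + δ) * (x : ℝ) :=
  eventually_twinTail_le_of_twinSieveUpperBound (by positivity) (twinSieveUpperBound_of_level_lt hθ₀ h) hε hε1 hδ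

/-- Consistency (an `example`, the statement being the landed `eventually_twinTail_le_mul`): the
Bombieri–Vinogradov THEOREM (`BombieriVinogradovStatement_holds`, `ϑ₀ = 1/2`) re-derives the unconditional ceiling
`T(x) ≤ (12C₂ + δ)·x` through the level route. -/
example {ε : ℝ} (hε : 0 < ε) (hε1 : ε < 1) {δ : ℝ} (hδ : 0 < δ) :
    ∀ᶠ x : ℕ in atTop,
      ∑ n ∈ Icc 1 x, ∑ e ∈ (n * (n + 2)).divisors with ⌊(x : ℝ) ^ (1 - ε)⌋₊ < e,
          (μ e : ℝ) * Real.log e ^ 2 ≤ (12 * twinPrimeConst + δ) * (x : ℝ) := by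
  filter_upwards [eventually_twinTail_le_of_level_lt (θ₀ := 1 / 2) (by norm_num)
    BombieriVinogradovStatement_holds hε hε1 hδ] with x hx
  have h12 : (4 * (2 / (1 / 2 : ℝ) - 1) * twinPrimeConst + δ) * (x : ℝ) = (12 * twinPrimeConst + δ) * x := by
    ring
  rwa [h12] at hx

/-! ### Elliott–Halberstam: the symmetric interval `[-4C₂, 4C₂]` -/

/-- **EH ⟹ `T(x) ≤ (4C₂ + δ)·x` eventually** (`δ > 0`): under the Elliott–Halberstam conjecture the sieve constant
is the parity constant `2` (`TwinSieveLevel.twinSieveUpperBound_two_of_EH`), and `4(2 - 1)C₂ = 4C₂` is the mirror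
image of the trivial lower bound `-(4C₂ + δ)·x` (`eventually_neg_mul_le_twinTail`).  EH is OPEN; a hypothesis. -/
theorem eventually_twinTail_le_of_EH (hEH : Literature.NumberTheory.Sieve.LevelOfDistribution.ElliottHalberstam)
    {ε : ℝ} (hε : 0 < ε) (hε1 : ε < 1) {δ : ℝ} (hδ : 0 < δ) :
    ∀ᶠ x : ℕ in atTop,
      ∑ n ∈ Icc 1 x, ∑ e ∈ (n * (n + 2)).divisors with ⌊(x : ℝ) ^ (1 - ε)⌋₊ < e,
          (μ e : ℝ) * Real.log e ^ 2 ≤ (4 * twinPrimeConst + δ) * (x : ℝ) := by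
  filter_upwards [eventually_twinTail_le_of_twinSieveUpperBound two_pos (twinSieveUpperBound_two_of_EH hEH)
    hε hε1 hδ] with x hx
  have h4 : (4 * (2 - 1) * twinPrimeConst + δ) * (x : ℝ) = (4 * twinPrimeConst + δ) * x := by ring
  rwa [h4] at hx

/-- **EH ⟹ `|T(x)| ≤ (4C₂ + δ)·x` eventually, for every `δ > 0`** — the symmetric interval: the unconditional floor
(`eventually_neg_mul_le_twinTail`, from `Λ₂ ≥ 0`) and the Elliott–Halberstam ceiling (`eventually_twinTail_le_of_EH`).
The twin prime conjecture is any dent `T(x) ≥ -(4C₂ - c)·x` infinitely often (`twinPrimeConjecture_of_frequently_twinTail_ge`);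
Hardy–Littlewood is `T(x) = o(x)`.  EH is a hypothesis and is not known to touch the left end. -/
theorem eventually_abs_twinTail_le_of_EH (hEH : Literature.NumberTheory.Sieve.LevelOfDistribution.ElliottHalberstam)
    {ε : ℝ} (hε : 0 < ε) (hε1 : ε < 1) {δ : ℝ} (hδ : 0 < δ) :
    ∀ᶠ x : ℕ in atTop,
      |∑ n ∈ Icc 1 x, ∑ e ∈ (n * (n + 2)).divisors with ⌊(x : ℝ) ^ (1 - ε)⌋₊ < e,
          (μ e : ℝ) * Real.log e ^ 2| ≤ (4 * twinPrimeConst + δ) * (x : ℝ) := by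
  filter_upwards [eventually_neg_mul_le_twinTail hε hε1 hδ, eventually_twinTail_le_of_EH hEH hε hε1 hδ]
    with x h₁ h₂
  exact abs_le.mpr ⟨by linarith, h₂⟩

/-- The same symmetric interval from the Wave0 form of the conjecture (parity.S25 `ElliottHalberstamConjecture`). -/
theorem eventually_abs_twinTail_le_of_elliottHalberstamConjecture (hEH : ElliottHalberstamConjecture)
    {ε : ℝ} (hε : 0 < ε) (hε1 : ε < 1) {δ : ℝ} (hδ : 0 < δ) :
    ∀ᶠ x : ℕ in atTop,
      |∑ n ∈ Icc 1 x, ∑ e ∈ (n * (n + 2)).divisors with ⌊(x : ℝ) ^ (1 - ε)⌋₊ < e,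
          (μ e : ℝ) * Real.log e ^ 2| ≤ (4 * twinPrimeConst + δ) * (x : ℝ) :=
  eventually_abs_twinTail_le_of_EH (Literature.NumberTheory.Sieve.elliottHalberstam_of_wave0 hEH) hε hε1 hδ

end Summit.Parity.BatemanHorn.Theorems
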